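import Mathlib
import HarnessLib

/-!
# Route `KLProgramme` — VL child `KLRegimeVolumeLimitV17F2` (stmt-HubbardSuperconductivity-20440), closer MODEL file M2 «MISMATCH-SLICE», bracket (c),
# part 2a (generic core): iterated forward differences of a ONE-PARAMETER family of symbols — the parameter derivative commutes with `Δ_hⁿ`, and the
# INCREMENT `Δ_hⁿ(F 1) − Δ_hⁿ(F 0)` is bounded by the sup over the parameter of `Δ_hⁿ` of the DERIVED family; the radial increment of a
# multiplier symbol `G(c + e_t²)·Z` along the interpolated band `e_t = e₀ + t(e₁ − e₀)`

Cell `gate-hubbard-kl`, seat hubbard-kl-k3c4-p2 (g11; UV / Matsubara all-U lane), ask «MISMATCH-SLICE» (= M2, bracket (c)) of the VL registrant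
k3c4-p1 g11 (KL STATUS 2026-08-27 21:51Z / 22:29Z).  The frame DEFECT of the re-sectorisation kernel (part 1, `…SectorOverlapDefectRows`) reduces
to character sums of the sampled symbol DIFFERENCE `Φ_K − Φ_{K″}`, `Φ_K(k₀,p) = G(k₀² + e_K(p)²)·Z(p)` (p4's `…SymbolFrameInstance`; the
angular factor `Z` is frame-FREE), whose pointwise second differences feed k3c2-p3's `sum_norm_charSum_le_of_second_differences`.  Writing
`e_t = e_{K″} + t·(e_K − e_{K″})`, the difference is the increment over `t ∈ [0,1]` of the family `F t = sample of G(k₀² + e_t²)·Z`, and by the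
mean value theorem on `t ↦ (Δ_wⁿ F t)(q)` it is bounded by `sup_t ‖Δ_wⁿ (∂_t F t)(q)‖` with `∂_t F t = sample of G′(k₀² + e_t²)·(2e_t·(e_K − e_{K″}))·Z`
— again a multiplier-type symbol (profile `G′`, band `e_t`, line factor `2e_t·v·Z` carrying the band increment `v`), to which p4's line-derivative
layer `…SymbolLineDerivTwo` / `…SymbolSampledDifferences` applies at every `t` (part 2b).

* §1 `fwdDiff_iter_apply_eq_sum_mul` (the shift formula with `ℂ` coefficients), **`hasDerivAt_fwdDiff_iter_apply`** — for `F : ℝ → M → ℂ` with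
  `HasDerivAt (t ↦ F t x) (F′ t x) t` at every `x`: `HasDerivAt (t ↦ Δ_hⁿ (F t) y) (Δ_hⁿ (F′ t) y) t`;
* §2 **`norm_fwdDiff_iter_sub_le_of_hasDerivAt`** — if moreover `‖Δ_hⁿ (F′ t) y‖ ≤ C` for `t ∈ [0,1)` then `‖Δ_hⁿ (F 1) y − Δ_hⁿ (F 0) y‖ ≤ C`,
  and `fwdDiff_iter_sub_apply` (`Δ_hⁿ (f − g) = Δ_hⁿ f − Δ_hⁿ g` pointwise);
* §3 **`hasDerivAt_radialIncrement`** — `d/dt [G(c + e_t²)·z] = G′(c + e_t²)·(2e_t(e₁ − e₀))·z` (`G` differentiable), its `ofReal` version, and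
  **`norm_fwdDiff_iter_symbolIncrement_le`** — for sampled symbols `q ↦ G(k₀(q)² + e_i(p(q))²)·Z(p(q))`, `i = 0, 1`:
  `‖Δ_wⁿ[sample Φ₁ − sample Φ₀](q)‖ ≤ C` whenever `‖Δ_wⁿ[sample of G′(k₀² + e_t²)·2e_t(e₁−e₀)·Z](q)‖ ≤ C` for all `t ∈ [0,1]`.

Pure calculus; no definitions, no named facts; nothing about the model is asserted. [folklore]
-/

noncomputable section

namespace Summit.HubbardSuperconductivity.HubbardSuperconductivity.Theorems.TorusFourierL2

set_option linter.dupNamespace false -- summit = problem name (single-conjunct summit), D-0017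

open Finset fwdDiff

/-! ## §1 The parameter derivative commutes with iterated forward differences -/

section Param

variable {M : Type*} [AddCommMonoid M]

/-- **The shift formula with complex coefficients**: `Δ_hⁿ f y = Σ_{k ≤ n} ((−1)^{n−k}·C(n,k) : ℂ)·f(y + k•h)`. [folklore] -/
theorem fwdDiff_iter_apply_eq_sum_mul (h : M) (f : M → ℂ) (n : ℕ) (y : M) :
    (fwdDiff h)^[n] f y = ∑ k ∈ range (n + 1), ((((-1 : ℤ) ^ (n - k) * n.choose k : ℤ) : ℂ)) * f (y + k • h) := by
  rw [fwdDiff_iter_eq_sum_shift]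
  refine sum_congr rfl fun k _ => ?_
  rw [zsmul_eq_mul]

/-- **The parameter derivative commutes with `Δ_hⁿ`**: if `t ↦ F t x` has derivative `F′ t x` at `t` for every `x`, then
`t ↦ Δ_hⁿ (F t) y` has derivative `Δ_hⁿ (F′ t) y` at `t` (a finite linear combination of point evaluations). [folklore] -/
theorem hasDerivAt_fwdDiff_iter_apply (h : M) (n : ℕ) (y : M) {F F' : ℝ → M → ℂ} {t : ℝ}
    (hF : ∀ x, HasDerivAt (fun t => F t x) (F' t x) t) :
    HasDerivAt (fun t => (fwdDiff h)^[n] (F t) y) ((fwdDiff h)^[n] (F' t) y) t := by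
  have hfun : (fun t => (fwdDiff h)^[n] (F t) y) =
      fun t => ∑ k ∈ range (n + 1), ((((-1 : ℤ) ^ (n - k) * n.choose k : ℤ) : ℂ)) * F t (y + k • h) := by
    funext t; rw [fwdDiff_iter_apply_eq_sum_mul]
  rw [hfun, fwdDiff_iter_apply_eq_sum_mul]
  exact HasDerivAt.fun_sum fun k _ => (hF (y + k • h)).const_mul _

/-- `Δ_hⁿ` of a difference, pointwise. [folklore] -/
theorem fwdDiff_iter_sub_apply (h : M) (f g : M → ℂ) (n : ℕ) (y : M) :
    (fwdDiff h)^[n] (fun x => f x - g x) y = (fwdDiff h)^[n] f y - (fwdDiff h)^[n] g y := by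
  rw [fwdDiff_iter_apply_eq_sum_mul, fwdDiff_iter_apply_eq_sum_mul, fwdDiff_iter_apply_eq_sum_mul, ← sum_sub_distrib]
  refine sum_congr rfl fun k _ => ?_
  ring

/-! ## §2 The increment of `Δ_hⁿ` over the parameter interval `[0,1]` -/

/-- **Mean-value bound of the increment**: if `t ↦ F t x` is differentiable with derivative `F′ t x` on `[0,1]` (every `x`) and
`‖Δ_hⁿ (F′ t) y‖ ≤ C` for `t ∈ [0,1)`, then `‖Δ_hⁿ (F 1) y − Δ_hⁿ (F 0) y‖ ≤ C`. [folklore] -/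
theorem norm_fwdDiff_iter_sub_le_of_hasDerivAt (h : M) (n : ℕ) (y : M) {F F' : ℝ → M → ℂ}
    (hF : ∀ t ∈ Set.Icc (0 : ℝ) 1, ∀ x, HasDerivAt (fun t => F t x) (F' t x) t) {C : ℝ}
    (hC : ∀ t ∈ Set.Ico (0 : ℝ) 1, ‖(fwdDiff h)^[n] (F' t) y‖ ≤ C) :
    ‖(fwdDiff h)^[n] (F 1) y - (fwdDiff h)^[n] (F 0) y‖ ≤ C :=
  norm_image_sub_le_of_norm_deriv_le_segment_01' (f := fun t => (fwdDiff h)^[n] (F t) y)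
    (fun t ht => (hasDerivAt_fwdDiff_iter_apply h n y (hF t ht)).hasDerivWithinAt) hC

/-- The same for the difference written as one function: `‖Δ_hⁿ (F 1 − F 0) y‖ ≤ C`. [folklore] -/
theorem norm_fwdDiff_iter_sub_le_of_hasDerivAt' (h : M) (n : ℕ) (y : M) {F F' : ℝ → M → ℂ}
    (hF : ∀ t ∈ Set.Icc (0 : ℝ) 1, ∀ x, HasDerivAt (fun t => F t x) (F' t x) t) {C : ℝ}
    (hC : ∀ t ∈ Set.Ico (0 : ℝ) 1, ‖(fwdDiff h)^[n] (F' t) y‖ ≤ C) :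
    ‖(fwdDiff h)^[n] (fun x => F 1 x - F 0 x) y‖ ≤ C := by
  rw [fwdDiff_iter_sub_apply]
  exact norm_fwdDiff_iter_sub_le_of_hasDerivAt h n y hF hC

end Param

/-! ## §3 The radial increment of a multiplier symbol along the interpolated band -/

section Radial

/-- **Derivative of the interpolated radial factor**: with `e_t = e₀ + t(e₁ − e₀)`,
`d/dt [G(c + e_t²)·z] = G′(c + e_t²)·(2e_t(e₁ − e₀))·z` (`G` differentiable). [folklore] -/
theorem hasDerivAt_radialIncrement {G : ℝ → ℝ} (hG : Differentiable ℝ G) (c e₀ e₁ z t : ℝ) :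
    HasDerivAt (fun t : ℝ => G (c + (e₀ + t * (e₁ - e₀)) ^ 2) * z)
      (deriv G (c + (e₀ + t * (e₁ - e₀)) ^ 2) * (2 * (e₀ + t * (e₁ - e₀)) * (e₁ - e₀)) * z) t := by
  have he : HasDerivAt (fun t : ℝ => e₀ + t * (e₁ - e₀)) (e₁ - e₀) t := by
    simpa using ((hasDerivAt_id t).mul_const (e₁ - e₀)).const_add e₀
  have hsq : HasDerivAt (fun t : ℝ => c + (e₀ + t * (e₁ - e₀)) ^ 2) (2 * (e₀ + t * (e₁ - e₀)) * (e₁ - e₀)) t := by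
    have h2 : HasDerivAt (fun t : ℝ => (e₀ + t * (e₁ - e₀)) ^ 2) (((2 : ℕ) : ℝ) * (e₀ + t * (e₁ - e₀)) ^ (2 - 1) * (e₁ - e₀)) t :=
      he.pow 2
    have h2' : HasDerivAt (fun t : ℝ => (e₀ + t * (e₁ - e₀)) ^ 2) (2 * (e₀ + t * (e₁ - e₀)) * (e₁ - e₀)) t := by
      convert h2 using 1; norm_num
    exact h2'.const_add c
  have hcomp : HasDerivAt (fun t : ℝ => G (c + (e₀ + t * (e₁ - e₀)) ^ 2))
      (deriv G (c + (e₀ + t * (e₁ - e₀)) ^ 2) * (2 * (e₀ + t * (e₁ - e₀)) * (e₁ - e₀))) t :=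
    (hG _).hasDerivAt.comp t hsq
  exact hcomp.mul_const z

/-- The `ofReal` version: `d/dt ((G(c + e_t²)·z : ℝ) : ℂ) = ((G′(c + e_t²)·2e_t(e₁−e₀)·z : ℝ) : ℂ)`. [folklore] -/
theorem hasDerivAt_radialIncrement_ofReal {G : ℝ → ℝ} (hG : Differentiable ℝ G) (c e₀ e₁ z t : ℝ) :
    HasDerivAt (fun t : ℝ => (((G (c + (e₀ + t * (e₁ - e₀)) ^ 2) * z : ℝ)) : ℂ))
      ((((deriv G (c + (e₀ + t * (e₁ - e₀)) ^ 2) * (2 * (e₀ + t * (e₁ - e₀)) * (e₁ - e₀)) * z : ℝ)) : ℂ)) t :=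
  (hasDerivAt_radialIncrement hG c e₀ e₁ z t).ofReal_comp

variable {M : Type*} [AddCommMonoid M] {X : Type*}

/-- **THE INCREMENT OF THE SAMPLED MULTIPLIER SYMBOL BETWEEN TWO BANDS.**  For a differentiable profile `G`, two bands `e₀, e₁ : X → ℝ`, a
factor `Z : X → ℝ`, sample coordinates `k₀ : M → ℝ`, `p : M → X`, and the sampled symbols `Sᵢ(q) = G(k₀(q)² + eᵢ(p q)²)·Z(p q)`: if for every
`t ∈ [0,1)` the `n`-th forward difference of the sampled DERIVED symbol `q ↦ G′(k₀² + e_t²)·(2e_t(e₁ − e₀))·Z` (`e_t = e₀ + t(e₁−e₀)`) at `y` has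
norm `≤ C`, then `‖Δ_hⁿ (S₁ − S₀)(y)‖ ≤ C`. [folklore] -/
theorem norm_fwdDiff_iter_symbolIncrement_le {G : ℝ → ℝ} (hG : Differentiable ℝ G) (e₀ e₁ Z : X → ℝ) (k₀ : M → ℝ) (p : M → X)
    (h : M) (n : ℕ) (y : M) {C : ℝ}
    (hC : ∀ t ∈ Set.Ico (0 : ℝ) 1, ‖(fwdDiff h)^[n] (fun q => (((deriv G (k₀ q ^ 2 + (e₀ (p q) + t * (e₁ (p q) - e₀ (p q))) ^ 2) *
        (2 * (e₀ (p q) + t * (e₁ (p q) - e₀ (p q))) * (e₁ (p q) - e₀ (p q))) * Z (p q) : ℝ)) : ℂ)) y‖ ≤ C) :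
    ‖(fwdDiff h)^[n] (fun q => (((G (k₀ q ^ 2 + e₁ (p q) ^ 2) * Z (p q) : ℝ)) : ℂ) - (((G (k₀ q ^ 2 + e₀ (p q) ^ 2) * Z (p q) : ℝ)) : ℂ)) y‖ ≤ C := by
  -- the one-parameter family and its derivative
  set F : ℝ → M → ℂ := fun t q => (((G (k₀ q ^ 2 + (e₀ (p q) + t * (e₁ (p q) - e₀ (p q))) ^ 2) * Z (p q) : ℝ)) : ℂ) with hFdef
  set F' : ℝ → M → ℂ := fun t q => (((deriv G (k₀ q ^ 2 + (e₀ (p q) + t * (e₁ (p q) - e₀ (p q))) ^ 2) *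
      (2 * (e₀ (p q) + t * (e₁ (p q) - e₀ (p q))) * (e₁ (p q) - e₀ (p q))) * Z (p q) : ℝ)) : ℂ) with hF'def
  have hF : ∀ t ∈ Set.Icc (0 : ℝ) 1, ∀ x, HasDerivAt (fun t => F t x) (F' t x) t := fun t _ x =>
    hasDerivAt_radialIncrement_ofReal hG (k₀ x ^ 2) (e₀ (p x)) (e₁ (p x)) (Z (p x)) t
  have h1 : F 1 = fun q => (((G (k₀ q ^ 2 + e₁ (p q) ^ 2) * Z (p q) : ℝ)) : ℂ) := by
    funext q; simp only [hFdef, one_mul, add_sub_cancel]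
  have h0 : F 0 = fun q => (((G (k₀ q ^ 2 + e₀ (p q) ^ 2) * Z (p q) : ℝ)) : ℂ) := by
    funext q; simp only [hFdef, zero_mul, add_zero]
  have hmain := norm_fwdDiff_iter_sub_le_of_hasDerivAt' h n y hF hC
  rw [h1, h0] at hmain
  exact hmain

end Radial

end Summit.HubbardSuperconductivity.HubbardSuperconductivity.Theorems.TorusFourierL2

end
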